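import Summits.ValiantsHypothesis.ValiantsHypothesis.Theorems.SymPencilSdcSuperquadraticStubDefectForm
import Summits.ValiantsHypothesis.ValiantsHypothesis.Theorems.SymPencilIsotropicKernelSquaresBilinear

/-!
# Route `SymPencil` — the ORIGIN PACKAGE of a symmetric representation of `per_4`, as data
# (interface for the rungs past `sdc(per_4) ≥ 23`; `--supports` stmt-ValiantsHypothesis-5674)

The pencil bookkeeping of `SymPencilSdcPerFourNineteen` / `…StubDefectForm.kernel_package_…` /
`SymPencilSdcPerFourKernelPackage.kernel_package₂_…` was so far re-run inside each consumer.  This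
file runs it ONCE MORE and exports the abstract data themselves
(`origin_package_of_isSymm_isAffineDetRepr_perPoly_four`), so that further readings of the origin
moments need no fourth copy: from a symmetric affine determinantal representation `A` of `per_4` of
size `m` (characteristic `0`) one gets an index `i₀`, an invertible symmetric `D` (the block of
`A₀` in the kernel normal form), linear families `bL` (kernel rows) and `CL` (symmetric blocks) on
`K^{4×4}`, and `κ ≠ 0`, satisfying the three origin-moment identities

 (i) `bᵀD⁻¹b ≡ 0`, (ii) `bᵀD⁻¹CD⁻¹b ≡ 0`, (iii) `det D · bᵀD⁻¹CD⁻¹CD⁻¹b = -κ·per_4`,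

together with: `ker bL ⊆ Sing Z(per_4)` (all `3 × 3` subpermanents vanish), `|ι'| + 1 = m`,
`2·dim im bL ≤ |ι'|` (isotropy), `dim im bL + dim ker bL = 16`, `dim ker bL ≤ 8` (BoxFour).

As the first consumer, the JOINT reading of the `s²`-coefficient
(`bilinear_package_of_isSymm_isAffineDetRepr_perPoly_four`, via
`SymPencilIsotropicKernelSquaresBilinear`): with `V = ker bL`, `r = dim im bL`, for every
`d ≥ (m - 1) - 2r` there are constants `c_j` and BILINEAR forms `β_j` (`j < d`) on `K^{16} × K^{16}`
with `per_4 (u + s y) = e₀ + s e₁ + s² Σ_{j<d} c_j β_j(u, y)²` for all `u` and all `y ∈ V` — the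
"inner rank ≤ d" statement of `Cruxes/SdcSuperquadratic/NEXT-RUNG-23.md` (Task T2), of which the
landed per-base-point and per-direction readings are the two partial evaluations.

Honest framing: interface/bookkeeping; the crux `SdcSuperquadratic` stays open; `VP ≠ VNP` is not
moved. [folklore]
-/

noncomputable section

-- single-conjunct layout: Sub = Summit, duplicated namespace component intended
set_option linter.dupNamespace false

namespace Summit.ValiantsHypothesis.ValiantsHypothesis.Theorems.SymPencilPerFourOriginPackage

open Matrix MvPolynomial Module
open Literature.Computability.AlgebraicComplexity
open Literature.Computability.AlgebraicComplexity.AlperBogartVelasco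
open Summit.ValiantsHypothesis.ValiantsHypothesis.Theorems.SymPencilHomogeneousHessianRank
open Summit.ValiantsHypothesis.ValiantsHypothesis.Theorems.SymPencilHomogeneousConeKernel
open Summit.ValiantsHypothesis.ValiantsHypothesis.Theorems.SymPencilHomogeneousDropRankCodim
open Summit.ValiantsHypothesis.ValiantsHypothesis.Theorems.SymPencilOriginMoments
open Summit.ValiantsHypothesis.ValiantsHypothesis.Theorems.SymPencilOriginNormalForm
open Summit.ValiantsHypothesis.ValiantsHypothesis.Theorems.SymPencilIsotropicKernelSquaresBilinear
open Summit.ValiantsHypothesis.ValiantsHypothesis.Theorems.SymPencilBoxFourEquality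

/-- **The origin package as data.**  See the module docstring. [folklore] -/
theorem origin_package_of_isSymm_isAffineDetRepr_perPoly_four (K : Type*) [Field K] [CharZero K]
    {m : ℕ} {A : Matrix (Fin m) (Fin m) (MvPolynomial (Fin 4 × Fin 4) K)}
    (hS : A.IsSymm) (hA : IsAffineDetRepr (perPoly (Fin 4) K) A) :
    ∃ (i₀ : Fin m) (D : Matrix {i // i ≠ i₀} {i // i ≠ i₀} K)
      (bL : (Fin 4 × Fin 4 → K) →ₗ[K] ({i // i ≠ i₀} → K))
      (CL : (Fin 4 × Fin 4 → K) →ₗ[K] Matrix {i // i ≠ i₀} {i // i ≠ i₀} K) (κ : K),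
      IsUnit D.det ∧ Dᵀ = D ∧ (∀ z, (CL z)ᵀ = CL z) ∧ κ ≠ 0 ∧
      (∀ z, bL z ⬝ᵥ D⁻¹ *ᵥ bL z = 0) ∧
      (∀ z, bL z ⬝ᵥ (D⁻¹ * CL z * D⁻¹) *ᵥ bL z = 0) ∧
      (∀ z, D.det * (bL z ⬝ᵥ (D⁻¹ * CL z * D⁻¹ * CL z * D⁻¹) *ᵥ bL z) =
        -(κ * eval z (perPoly (Fin 4) K))) ∧
      (∀ x ∈ LinearMap.ker bL, ∀ r c : Fin 4,
        ((Matrix.of fun i j => x (i, j)).submatrix r.succAbove c.succAbove).permanent = 0) ∧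
      Fintype.card {i // i ≠ i₀} + 1 = m ∧
      2 * finrank K (LinearMap.range bL) ≤ Fintype.card {i // i ≠ i₀} ∧
      finrank K (LinearMap.range bL) + finrank K (LinearMap.ker bL) = 16 ∧
      finrank K (LinearMap.ker bL) ≤ 8 := by
  classical
  obtain ⟨hdeg, hdet⟩ := hA
  have hhom : (perPoly (Fin 4) K).IsHomogeneous 4 := by
    simpa using (perPoly_isHomogeneous (n := Fin 4) (k := K))
  -- the pencil `A = A₀ + Σ_v X_v A_v`
  set A₀ : Matrix (Fin m) (Fin m) K := constPart A with hA₀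
  let Mlin : (Fin 4 × Fin 4 → K) →ₗ[K] Matrix (Fin m) (Fin m) K :=
    { toFun := fun z => ∑ v, z v • LRPencil.coeffMat A v
      map_add' := fun z₁ z₂ => by
        simp only [Pi.add_apply, add_smul, Finset.sum_add_distrib]
      map_smul' := fun c z => by
        simp only [Pi.smul_apply, smul_eq_mul, mul_smul, Finset.smul_sum, RingHom.id_apply] }
  have hMlin : ∀ z, Mlin z = ∑ v, z v • LRPencil.coeffMat A v := fun z => rfl
  have hAz : ∀ z, A.map (eval z) = A₀ + Mlin z := fun z => by
    rw [hMlin, hA₀]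
    exact LRPencil.map_eval_eq A hdeg z
  have hdetz : ∀ z, (A₀ + Mlin z).det = eval z (perPoly (Fin 4) K) := fun z => by
    rw [← hAz, ← RingHom.mapMatrix_apply, ← RingHom.map_det, hdet]
  have hcoeffs : ∀ v, (LRPencil.coeffMat A v)ᵀ = LRPencil.coeffMat A v := fun v => by
    ext i j; simp only [transpose_apply, LRPencil.coeffMat_apply, hS.apply i j]
  have hA₀s : A₀ᵀ = A₀ := by
    ext i j; simp only [hA₀, transpose_apply, constPart_apply, hS.apply i j]
  have hMs : ∀ z, (Mlin z)ᵀ = Mlin z := fun z => by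
    rw [hMlin, Matrix.transpose_sum]
    exact Finset.sum_congr rfl fun v _ => by rw [Matrix.transpose_smul, hcoeffs]
  have hMsingle : ∀ v, Mlin (Pi.single v 1) = LRPencil.coeffMat A v := fun v => by
    rw [hMlin]
    rw [Finset.sum_eq_single v (fun u _ hu => by rw [Pi.single_eq_of_ne hu, zero_smul])
      (fun h => absurd (Finset.mem_univ v) h), Pi.single_eq_same, one_smul]
  -- regularity everywhere (von zur Gathen) and the kernel vector of `A₀`
  have hreg : ∀ x : Fin 4 × Fin 4 → K, m ≤ (A₀ + Mlin x).rank + 1 := fun x => by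
    have h := AlperBogartVelasco.le_rank_map_eval_add_one two_ne_zero (by norm_num) A hdet x
    rwa [hAz] at h
  have hA₀det : A₀.det = 0 := by
    have h := hdetz 0
    rw [map_zero, add_zero] at h
    rw [h]
    have h0 := eval_smul_of_isHomogeneous hhom (0 : K) (0 : Fin 4 × Fin 4 → K)
    rwa [zero_smul, zero_pow (by norm_num), zero_mul] at h0
  obtain ⟨w, hw, hA₀w⟩ := Matrix.exists_mulVec_eq_zero_iff.mpr hA₀det
  have hrank0 : m ≤ A₀.rank + 1 := by simpa using hreg 0
  -- the reindexing through `i₀` with `w i₀ ≠ 0`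
  obtain ⟨i₀, hi₀⟩ : ∃ i, w i ≠ 0 := Function.ne_iff.mp hw
  let e : Fin m ≃ Unit ⊕ {i // i ≠ i₀} :=
    { toFun := fun i => if h : i = i₀ then Sum.inl () else Sum.inr ⟨i, h⟩
      invFun := Sum.elim (fun _ => i₀) fun i => i.1
      left_inv := fun i => by
        by_cases h : i = i₀
        · simp [h]
        · simp [h]
      right_inv := by
        rintro (u | ⟨i, hi⟩)
        · simp
        · simp [hi] }
  have he0 : e.symm (Sum.inl ()) = i₀ := rfl
  have hcard : Fintype.card {i // i ≠ i₀} + 1 = m := by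
    have hc : Fintype.card (Fin m) = Fintype.card (Unit ⊕ {i // i ≠ i₀}) := Fintype.card_congr e
    rw [Fintype.card_sum, Fintype.card_unit, Fintype.card_fin] at hc
    omega
  set w' : Unit ⊕ {i // i ≠ i₀} → K := w ∘ e.symm with hw'
  have hre : ∀ N : Matrix (Fin m) (Fin m) K, Matrix.reindex e e N *ᵥ w' = (N *ᵥ w) ∘ e.symm := by
    intro N
    rw [Matrix.reindex_apply, Matrix.submatrix_mulVec_equiv]
    have hwe : w' ∘ e.symm.symm = w := by
      ext i
      simp [hw']
    rw [hwe]
  have hdot : ∀ u : Fin m → K, w' ⬝ᵥ (u ∘ e.symm) = w ⬝ᵥ u := fun u => by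
    rw [hw']
    exact Fintype.sum_equiv e.symm _ _ fun i => rfl
  set A₀' : Matrix (Unit ⊕ {i // i ≠ i₀}) (Unit ⊕ {i // i ≠ i₀}) K := Matrix.reindex e e A₀
    with hA₀'
  let Rm : Matrix (Fin m) (Fin m) K →ₗ[K]
      Matrix (Unit ⊕ {i // i ≠ i₀}) (Unit ⊕ {i // i ≠ i₀}) K :=
    (Matrix.reindexLinearEquiv K K e e).toLinearMap
  have hRm : ∀ N, Rm N = Matrix.reindex e e N := fun N => rfl
  set M' := Rm ∘ₗ Mlin with hM'
  have hM'z : ∀ z, M' z = Matrix.reindex e e (Mlin z) := fun z => rfl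
  have hA₀'s : A₀'ᵀ = A₀' := by rw [hA₀', Matrix.transpose_reindex, hA₀s]
  have hM's : ∀ z, (M' z)ᵀ = M' z := fun z => by rw [hM'z, Matrix.transpose_reindex, hMs]
  have hw'0 : w' (Sum.inl ()) ≠ 0 := by rw [hw', Function.comp_apply, he0]; exact hi₀
  have hA₀'w : A₀' *ᵥ w' = 0 := by rw [hA₀', hre, hA₀w]; rfl
  have hrank' : Fintype.card {i // i ≠ i₀} ≤ A₀'.rank := by
    rw [hA₀', Matrix.rank_reindex]; omega
  -- the origin normal form and homogeneity
  obtain ⟨hD, hDs, hCs, hblocks⟩ := det_origin_blocks A₀' hA₀'s w' hw'0 hA₀'w hrank' M' hM's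
  set D := A₀'.toBlocks₂₂ with hDdef
  have hdet' : ∀ (s : K) (z : Fin 4 × Fin 4 → K),
      (A₀' + s • M' z).det = s ^ 4 * eval z (perPoly (Fin 4) K) := by
    intro s z
    have h1 : A₀' + s • M' z = Matrix.reindex e e (A₀ + Mlin (s • z)) := by
      rw [hA₀', hM'z, map_smul]
      rfl
    rw [h1, Matrix.reindex_apply, Matrix.det_submatrix_equiv_self, hdetz,
      eval_smul_of_isHomogeneous hhom]
  -- the kernel-row and block families as linear maps
  let bL : (Fin 4 × Fin 4 → K) →ₗ[K] ({i // i ≠ i₀} → K) :=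
    { toFun := fun z i => (M' z *ᵥ w') (Sum.inr i)
      map_add' := fun z₁ z₂ => by
        ext i; simp only [map_add, Matrix.add_mulVec, Pi.add_apply]
      map_smul' := fun c z => by
        ext i; simp only [map_smul, Matrix.smul_mulVec, Pi.smul_apply, RingHom.id_apply] }
  have hbL : ∀ z, bL z = fun i => (M' z *ᵥ w') (Sum.inr i) := fun z => rfl
  let CL : (Fin 4 × Fin 4 → K) →ₗ[K] Matrix {i // i ≠ i₀} {i // i ≠ i₀} K :=
    { toFun := fun z => (M' z).toBlocks₂₂
      map_add' := fun z₁ z₂ => by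
        ext i j; simp only [map_add, Matrix.toBlocks₂₂, Matrix.add_apply, Matrix.of_apply]
      map_smul' := fun c z => by
        ext i j
        simp only [map_smul, Matrix.toBlocks₂₂, Matrix.smul_apply, Matrix.of_apply,
          RingHom.id_apply] }
  have hCL : ∀ z, CL z = (M' z).toBlocks₂₂ := fun z => rfl
  -- the origin moments, for every `z`
  have hmom : ∀ z : Fin 4 × Fin 4 → K, w' ⬝ᵥ M' z *ᵥ w' = 0 ∧ bL z ⬝ᵥ D⁻¹ *ᵥ bL z = 0 ∧
      bL z ⬝ᵥ (D⁻¹ * CL z * D⁻¹) *ᵥ bL z = 0 ∧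
      D.det * (bL z ⬝ᵥ (D⁻¹ * CL z * D⁻¹ * CL z * D⁻¹) *ᵥ bL z) =
        -(w' (Sum.inl ()) ^ 2 * eval z (perPoly (Fin 4) K)) := by
    intro z
    refine moments_four hD (w' ⬝ᵥ M' z *ᵥ w') (w' (Sum.inl ()) ^ 2) (eval z (perPoly (Fin 4) K))
      (bL z) fun s => ?_
    rw [hbL, hCL, hDdef, ← hblocks s z, hdet']
    ring
  have ha : ∀ z, w' ⬝ᵥ M' z *ᵥ w' = 0 := fun z => (hmom z).1
  -- `ker bL`: the kernel rows vanish entirely, so `A(v) w = 0`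
  have hMw : ∀ v, bL v = 0 → Mlin v *ᵥ w = 0 := by
    intro v hv
    have h1 : M' v *ᵥ w' = 0 := by
      have hinr : ∀ i, (M' v *ᵥ w') (Sum.inr i) = 0 := fun i => by
        have := congr_fun hv i
        rwa [hbL] at this
      have hinl : (M' v *ᵥ w') (Sum.inl ()) = 0 := by
        have h := ha v
        rw [dotProduct, Fintype.sum_sum_type] at h
        simp only [Finset.univ_unique, Finset.sum_singleton, hinr, mul_zero,
          Finset.sum_const_zero, add_zero, PUnit.default_eq_unit] at h
        exact (mul_eq_zero.1 h).resolve_left hw'0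
      ext (u | i)
      · exact hinl
      · exact hinr i
    rw [hM'z, hre] at h1
    ext j
    have := congr_fun h1 (e j)
    simpa using this
  -- all first partials of `per_4` vanish on `ker bL`
  have hpart : ∀ v, bL v = 0 → ∀ u : Fin 4 × Fin 4,
      eval v (pderiv u (perPoly (Fin 4) K)) = 0 := by
    intro v hv u
    set Y : Matrix (Fin m) (Fin m) K := A₀ + Mlin v with hYdef
    have hYs : Yᵀ = Y := by rw [hYdef, Matrix.transpose_add, hA₀s, hMs]
    have hYw : Y *ᵥ w = 0 := by rw [hYdef, Matrix.add_mulVec, hA₀w, hMw v hv, add_zero]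
    obtain ⟨c₀, hc₀⟩ := adjugate_eq_smul_vecMulVec hYs hw hYw (by
      have h := hreg v; rw [Fintype.card_fin]; exact h)
    rw [← hdet, DeterminantalConormal.eval_pderiv_det, hAz, ← hYdef, hc₀]
    have hcoe : A.map (fun p => eval v (pderiv u p)) = LRPencil.coeffMat A u := by
      ext i j
      simp only [Matrix.map_apply, LRPencil.coeffMat_apply,
        AlperBogartVelasco.pderiv_eq_C_coeff (hdeg i j), eval_C]
    rw [hcoe, Matrix.smul_mul, Matrix.trace_smul, Matrix.vecMulVec_mul, Matrix.trace_vecMulVec,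
      smul_eq_mul, ← Matrix.mulVec_transpose, hcoeffs, ← hMsingle, ← hdot, ← hre, ← hM'z,
      ha, mul_zero]
  -- `ker bL ⊆ Sing Z(per_4)` in both forms, and its dimension `≤ 8` (BoxFour)
  have hV4 : ∀ x ∈ LinearMap.ker bL, ∀ r c : Fin 4,
      ((Matrix.of fun i j => x (i, j)).submatrix r.succAbove c.succAbove).permanent = 0 := by
    intro x hx r c
    rw [← eval_pderiv_perPoly_eq_permanent_submatrix]
    exact hpart x (LinearMap.mem_ker.1 hx) (r, c)
  have hkerle : finrank K (LinearMap.ker bL) ≤ 8 :=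
    finrank_le_eight_of_subperm_three_vanish (LinearMap.ker bL) hV4
  -- dimension of the image: `2 r ≤ m - 1` (isotropy)
  have hDis : (D⁻¹)ᵀ = D⁻¹ := by rw [Matrix.transpose_nonsing_inv, hDs]
  have hDiu : IsUnit D⁻¹ :=
    (Matrix.isUnit_iff_isUnit_det _).2 (Matrix.isUnit_nonsing_inv_det_iff.2 hD)
  have hranle : 2 * finrank K (LinearMap.range bL) ≤ Fintype.card {i // i ≠ i₀} := by
    have h := rank_add_two_mul_finrank_le_of_quadratic_form_eq_zero hDis (LinearMap.range bL)
      (by rintro _ ⟨z, rfl⟩; exact (hmom z).2.1)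
    rw [Matrix.rank_of_isUnit _ hDiu] at h
    omega
  have hrn := LinearMap.finrank_range_add_finrank_ker bL
  rw [Module.finrank_fintype_fun_eq_card, Fintype.card_prod, Fintype.card_fin] at hrn
  have hκ : w' (Sum.inl ()) ^ 2 ≠ 0 := pow_ne_zero 2 hw'0
  exact ⟨i₀, D, bL, CL, w' (Sum.inl ()) ^ 2, hD, hDs, hCs, hκ, fun z => (hmom z).2.1,
    fun z => (hmom z).2.2.1, fun z => (hmom z).2.2.2, hV4, hcard, hranle, hrn, hkerle⟩

/-- **The bilinear ("inner rank") package.**  A symmetric affine determinantal representation of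
`per_4` of size `m` (characteristic `0`) yields `V ⊆ Sing Z(per_4)` and `r` with `dim V + r = 16`,
`2r + 1 ≤ m`, `dim V ≤ 8`, and for every `d` with `m ≤ 2r + 1 + d` constants `c_j` and bilinear
forms `β_j` (`j < d`) with `per_4 (u + s y) = e₀ + s e₁ + s² Σ_{j<d} c_j β_j(u, y)²` for every base
point `u` and every `y ∈ V`. [folklore] -/
theorem bilinear_package_of_isSymm_isAffineDetRepr_perPoly_four (K : Type*) [Field K] [CharZero K]
    {m : ℕ} {A : Matrix (Fin m) (Fin m) (MvPolynomial (Fin 4 × Fin 4) K)}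
    (hS : A.IsSymm) (hA : IsAffineDetRepr (perPoly (Fin 4) K) A) :
    ∃ (r : ℕ) (V : Submodule K (Fin 4 × Fin 4 → K)),
      finrank K V + r = 16 ∧ 2 * r + 1 ≤ m ∧ finrank K V ≤ 8 ∧
      (∀ x ∈ V, ∀ (r c : Fin 3 → Fin 4), Function.Injective r → Function.Injective c →
        ((Matrix.of fun i j => x (i, j)).submatrix r c).permanent = 0) ∧
      ∀ d : ℕ, m ≤ 2 * r + 1 + d →
        ∃ (c : Fin d → K)
          (β : Fin d → ((Fin 4 × Fin 4 → K) →ₗ[K] (Fin 4 × Fin 4 → K) →ₗ[K] K)),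
          ∀ u : Fin 4 × Fin 4 → K, ∀ y ∈ V, ∃ e₀ e₁ : K, ∀ s : K,
            eval (u + s • y) (perPoly (Fin 4) K) =
              e₀ + s * e₁ + s ^ 2 * ∑ k, c k * (β k u y) ^ 2 := by
  classical
  obtain ⟨i₀, D, bL, CL, κ, hD, hDs, hCs, hκ, hi, hii, hiii, hV4, hcard, hranle, hrn, hkerle⟩ :=
    origin_package_of_isSymm_isAffineDetRepr_perPoly_four K hS hA
  refine ⟨finrank K (LinearMap.range bL), LinearMap.ker bL, by omega, by omega, hkerle,
    fun x hx r c hr hc => subperm_vanish_inj_of_succAbove x (hV4 x hx) r c hr hc, fun d hd => ?_⟩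
  have hL : Fintype.card {i // i ≠ i₀} ≤ 2 * finrank K (LinearMap.range bL) + d := by omega
  obtain ⟨c, β, hcβ⟩ := sum_sq_of_isotropic_defect_bilinear hD hDs bL CL hCs
    (fun z => eval z (perPoly (Fin 4) K)) hκ hi hii hiii d hL
  exact ⟨c, β, fun u y hy => hcβ u y (LinearMap.mem_ker.1 hy)⟩

end Summit.ValiantsHypothesis.ValiantsHypothesis.Theorems.SymPencilPerFourOriginPackage

end
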